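import Literature.AlgebraicGeometry.HodgeTheory.FermatHodgeConjectureAokiProofs
import Literature.AlgebraicGeometry.HodgeTheory.FermatClaimShiodaSpine
import HarnessLib

/-!
# Level raising of Hodge multisets, the reduction of `stub_levelChange` (S2) to pull-back/push-forward, and the certificate toolkit — line `cancel-by-any-claim-lattice`, crux `HodgeFermatVarieties` (stmt-HodgeConjecture-1334)

Level raising `s ↦ k • s` along the finite `μ`-equivariant morphism
`π : Xⁿ_{km} → Xⁿₘ`, `[xᵢ] ↦ [xᵢᵏ]` (Shioda–Katsura, Tôhoku Math. J. 31 (1979) §1; Aoki,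
J. Math. Soc. Japan 39 (1987) p. 387 and Cor. 2-3; da Silva, arXiv:2101.04739 Thm. 2.8).

PART (a), PROVED here (`isHodgeMultiset_levelRaise`, arithmetic only): for `k ≥ 1` and a Hodge
multiset `s` of level `m`, the multiset `k • s = {k⟨a⟩ : a ∈ s}` of level `km` is a Hodge multiset —
zero-free (`0 < k⟨a⟩ < km`), sum zero (`Σ k⟨aᵢ⟩ = k Σ⟨aᵢ⟩`, `m ∣ Σ⟨aᵢ⟩`), and for a unit `T` of
`ℤ/km` with image `t̄ ∈ (ℤ/m)ˣ` (`ZMod.unitsMap`), `⟨T · k⟨a⟩⟩_{km} = k ⟨t̄ a⟩_m`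
(`Nat.mul_mod_mul_left`), so `2 · mNormSum (T • (k • s)) = k · (2 · mNormSum (t̄ • s)) = km · #s`.

PART (b) (`claim_m(s) ⟺ claim_{km}(k • s)`) is the geometric half. PROVED here is its reduction
`claimMultiset_levelRaise_iff_of_pull_push` to two character-level inputs about `π`, taken as
explicit hypotheses: `hPull` (claim_m(α') ⟹ claim_{km}(k • α') for zero-free `α'`; by `π^*` — in
the divisor spelling VERBATIM the hypothesis `hDeg` of `FermatCharacter.claim_std_of_claims`,
`levelPull_of_hDeg` / `hDeg_of_levelPull`) and `hPush` (the converse; by `π_* π^* = deg π ≠ 0`).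
NOT here, and not in the tree (status 2026-08-16): the morphism
`fermatHypersurface n (k*m) ⟶ fermatHypersurface n m` itself (the graded endomorphism `xᵢ ↦ xᵢᵏ` of
`ℂ[x₀, …, x_{n+1}]` multiplies degrees by `k`, outside Mathlib's `Proj.map`), its flatness, its
action `π^* V_m(β) ⊆ V_{km}(kβ)` on `fermatEigenspace`, the identification
`V_{km}(kα') ⊆ range π^*` (cohomology of the quotient `X_{km}/μₖⁿ⁺²` = invariants, or Ran's
`dim V(α) ≤ 1`), and the degree `HasDegree _ _ π(ℂ) (k^(n+1))` feeding `gysinMap_map_of_hasDegree`.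

## References

* [ShiodaKatsura1979] T. Shioda, T. Katsura, On Fermat varieties, Tôhoku Math. J. 31 (1979)
  97–115, §1 (doi:10.2748/tmj/1178229881).
* [Aoki1987] N. Aoki, Some new algebraic cycles on Fermat varieties, J. Math. Soc. Japan 39 (1987)
  385–396, p. 387 and Cor. 2-3.
* [daSilva2021HodgeFermat] G. da Silva Jr., arXiv:2101.04739, Thm. 2.8.
* [Shioda1979PJA] T. Shioda, Proc. Japan Acad. 55A (1979) 111–114, §1 (the semigroup `Mₘ`).
-/

set_option linter.dupNamespace false

noncomputable section

open CategoryTheory AlgebraicGeometry Finset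
open Literature.AlgebraicGeometry Literature.AlgebraicGeometry.Motives
open Literature.AlgebraicGeometry.HodgeTheory Literature.AlgebraicGeometry.HodgeTheory.FermatCharacter
open Literature.AlgebraicTopology.SingularHomology

namespace Summit.HodgeConjecture.HodgeConjecture.Theorems.CancelByAnyClaimLattice

/-- `LevelRaise[k, m, s]` — level raising `s ↦ k • s` (local notation of the line, verbatim). -/
local notation3 (prettyPrint := false) "LevelRaise[" k ", " m ", " s "]" =>
  Multiset.map (fun a : ZMod m => ((k * ZMod.val a : ℕ) : ZMod (k * m))) s

variable {m : ℕ}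

/-- The sum of the representatives of a multiset of residues, read back in `ℤ/m`, is its sum:
`(Σ ⟨a⟩ : ℤ/m) = Σ a`. [folklore] -/
theorem natCast_mNormSum [NeZero m] (s : Multiset (ZMod m)) : ((mNormSum s : ℕ) : ZMod m) = s.sum := by
  induction s using Multiset.induction_on with
  | empty => simp [mNormSum]
  | cons a s ih =>
    unfold mNormSum at ih ⊢
    rw [Multiset.map_cons, Multiset.sum_cons, Multiset.sum_cons, Nat.cast_add, ih, ZMod.natCast_zmod_val]

/-- A Hodge multiset has `m ∣ Σ ⟨a⟩` (its sum vanishes in `ℤ/m`). [cite: Shioda1979PJA, §1 eq. (3)] -/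
theorem dvd_mNormSum_of_sum_eq_zero [NeZero m] {s : Multiset (ZMod m)} (hs : s.sum = 0) : m ∣ mNormSum s := by
  rw [← ZMod.natCast_eq_zero_iff, natCast_mNormSum, hs]

/-- **`⟨T · (k⟨a⟩)⟩_{km} = k · ⟨t̄ a⟩_m`** for `T ∈ ℤ/km` with image `t̄ = T mod m`: since
`T · k⟨a⟩ = k (T ⟨a⟩)` and `k x mod km = k (x mod m)` (`Nat.mul_mod_mul_left`).
[cite: Aoki1987, §1 p. 387 (the elements g·σ of level m from level m/g)] -/
theorem val_mul_levelRaise {k : ℕ} [NeZero m] [NeZero (k * m)] (T : ZMod (k * m)) (a : ZMod m) :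
    (T * ((k * a.val : ℕ) : ZMod (k * m))).val = k * ((T.cast : ZMod m) * a).val := by
  have h1 : (T.cast : ZMod m) * a = ((T.val * a.val : ℕ) : ZMod m) := by
    rw [Nat.cast_mul, ZMod.natCast_zmod_val, ZMod.cast_eq_val]
  have h2 : T * ((k * a.val : ℕ) : ZMod (k * m)) = ((T.val * (k * a.val) : ℕ) : ZMod (k * m)) := by
    rw [Nat.cast_mul T.val, ZMod.natCast_zmod_val]
  rw [h1, h2, ZMod.val_natCast, ZMod.val_natCast, Nat.mul_left_comm, Nat.mul_mod_mul_left]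

/-- **`mNormSum (T • (k • s)) = k · mNormSum (t̄ • s)`**, summing `val_mul_levelRaise` over `s`.
[cite: Aoki1987, §1 p. 387] -/
theorem mNormSum_map_mul_levelRaise {k : ℕ} [NeZero m] [NeZero (k * m)] (T : ZMod (k * m))
    (s : Multiset (ZMod m)) :
    mNormSum ((LevelRaise[k, m, s]).map fun b => T * b) = k * mNormSum (s.map fun a => (T.cast : ZMod m) * a) := by
  unfold mNormSum
  rw [Multiset.map_map, Multiset.map_map, Multiset.map_map, ← Multiset.sum_map_mul_left]
  congr 1
  refine Multiset.map_congr rfl fun a _ => ?_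
  simp only [Function.comp_apply]
  exact val_mul_levelRaise T a

/-- The image in `(ℤ/m)ˣ` of a unit `T` of `ℤ/km` (`ZMod.unitsMap` along `m ∣ km`) is `T mod m`.
[folklore] -/
theorem coe_unitsMap_levelRaise {k : ℕ} [NeZero m] (T : (ZMod (k * m))ˣ) :
    ((ZMod.unitsMap (dvd_mul_left m k) T : (ZMod m)ˣ) : ZMod m) = (T : ZMod (k * m)).cast := by
  rw [ZMod.unitsMap_def, Units.coe_map, MonoidHom.coe_coe, ZMod.castHom_apply]

/-- **PART (a) of `stub_levelChange`: level raising preserves Hodge multisets.** For `k ≥ 1` and a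
Hodge multiset `s` of level `m` (Shioda's `Mₘ`), `k • s = {k⟨a⟩ : a ∈ s}` is a Hodge multiset of
level `km`: zero-free since `0 < k⟨a⟩ < km`; sum zero since `Σ k⟨aᵢ⟩ = k · Σ⟨aᵢ⟩` and
`m ∣ Σ⟨aᵢ⟩`; and for every unit `T` of `ℤ/km` with image `t̄ ∈ (ℤ/m)ˣ`,
`2 · Σ_{a ∈ s} ⟨T · k⟨a⟩⟩_{km} = k · 2 · Σ_{a ∈ s} ⟨t̄ a⟩_m = k · m · #s` (`val_mul_levelRaise` and
the Hodge condition of `s` at `t̄`). This is the arithmetic shadow of `π^* V_m(α) ⊆ V_{km}(kα)` for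
`π : Xⁿ_{km} → Xⁿₘ`, `[xᵢ] ↦ [xᵢᵏ]` (the characters `g · σ` of level `m` coming from level `m/g`).
[cite: Aoki1987, §1 p. 387 and Cor. 2-3 (p. 388)] [cite: daSilva2021HodgeFermat, Thm. 2.8]
[cite: Shioda1979PJA, §1 eqs. (2), (3)] -/
theorem isHodgeMultiset_levelRaise :
    ∀ (m k : ℕ) [NeZero m], 0 < k → ∀ s : Multiset (ZMod m), s ≠ 0 → IsHodgeMultiset s →
      IsHodgeMultiset (LevelRaise[k, m, s]) := by
  intro m k _ hk s _ hs
  haveI : NeZero (k * m) := ⟨Nat.mul_ne_zero hk.ne' (NeZero.ne m)⟩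
  refine ⟨⟨?_, ?_⟩, fun T => ?_⟩
  · -- zero-free: `km ∣ k⟨a⟩` forces `m ∣ ⟨a⟩ < m`, i.e. `a = 0`
    intro b hb h0
    obtain ⟨a, ha, rfl⟩ := Multiset.mem_map.mp hb
    rw [ZMod.natCast_eq_zero_iff] at h0
    have hval : a.val = 0 :=
      Nat.eq_zero_of_dvd_of_lt ((Nat.mul_dvd_mul_iff_left hk).mp h0) (ZMod.val_lt a)
    exact hs.1.1 a ha ((ZMod.val_eq_zero a).mp hval)
  · -- sum zero: `Σ k⟨aᵢ⟩ = k · mNormSum s` and `m ∣ mNormSum s`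
    have hmap : (LevelRaise[k, m, s]) = (s.map fun a : ZMod m => k * a.val).map (Nat.cast : ℕ → ZMod (k * m)) := by
      rw [Multiset.map_map]
      rfl
    rw [hmap, ← Nat.cast_multiset_sum, Multiset.sum_map_mul_left, ZMod.natCast_eq_zero_iff]
    exact mul_dvd_mul_left k (dvd_mNormSum_of_sum_eq_zero hs.1.2)
  · -- the unit condition at `T`, from that of `s` at `t̄ = T mod m`
    have hT := hs.2 (ZMod.unitsMap (dvd_mul_left m k) T)
    rw [coe_unitsMap_levelRaise] at hT
    rw [mNormSum_map_mul_levelRaise, Multiset.card_map, Nat.mul_left_comm, hT]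
    ring

/-! ### Part (b) reduced to its two geometric inputs (bookkeeping only; NOT the stub)

The equivalence `claim_m(s) ⟺ claim_{km}(k • s)` follows from two CHARACTER-level statements about
the morphism `π : X²ʳ_{km} → X²ʳₘ`, `[xᵢ] ↦ [xᵢᵏ]` — the pull-back `hPull` (`π^* V_m(α') = V_{km}(kα')`
and `π^*(Alg) ⊆ Alg`; in the divisor spelling this is VERBATIM the hypothesis `hDeg` of
`FermatCharacter.claim_std_of_claims`, see `levelPull_of_hDeg`) and the push-forward `hPush`
(`π_* π^* = deg π ≠ 0`, `π_*(Alg) ⊆ Alg`). Neither is in the tree (no morphism between Fermat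
hypersurfaces of different degrees exists yet); the multiset bookkeeping around them is proved here. -/

/-- **The pull-back input in the divisor spelling implies it in the multiple spelling**: the
hypothesis `hDeg` of `FermatCharacter.claim_std_of_claims` / `Aoki1987_primePow_of_inputs`
(claim at level `m/g` for a zero-free `α'` ⟹ claim of `g • α'` at level `m`), specialised to the
level `km` and `g = k` (`km / k = m`). [cite: Aoki1987, Cor. 2-3 (p. 388)] [cite: daSilva2021HodgeFermat, Thm. 2.8] -/
theorem levelPull_of_hDeg
    (hDeg : ∀ (m g r : ℕ) (α' : Fin (2 * r + 2) → ZMod (m / g)) (α : Fin (2 * r + 2) → ZMod m),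
      0 < g → g ∣ m → (∀ i, α' i ≠ 0) → (∀ i, α i = ((g * (α' i).val : ℕ) : ZMod m)) →
      FermatCharacter.Claim (m / g) r α' → FermatCharacter.Claim m r α) :
    ∀ (m k r : ℕ) (α' : Fin (2 * r + 2) → ZMod m), 0 < k → (∀ i, α' i ≠ 0) →
      FermatCharacter.Claim m r α' →
        FermatCharacter.Claim (k * m) r (fun i => ((k * (α' i).val : ℕ) : ZMod (k * m))) := by
  intro m k r α' hk hne hC
  have h := hDeg (k * m) k r
  rw [Nat.mul_div_cancel_left m hk] at h
  exact h α' _ hk (dvd_mul_right k m) hne (fun _ => rfl) hC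

/-- Conversely, the multiple spelling gives back the divisor spelling `hDeg` (write `m = g · M`,
`m / g = M`). [cite: Aoki1987, Cor. 2-3 (p. 388)] -/
theorem hDeg_of_levelPull
    (hPull : ∀ (m k r : ℕ) (α' : Fin (2 * r + 2) → ZMod m), 0 < k → (∀ i, α' i ≠ 0) →
      FermatCharacter.Claim m r α' →
        FermatCharacter.Claim (k * m) r (fun i => ((k * (α' i).val : ℕ) : ZMod (k * m)))) :
    ∀ (m g r : ℕ) (α' : Fin (2 * r + 2) → ZMod (m / g)) (α : Fin (2 * r + 2) → ZMod m),
      0 < g → g ∣ m → (∀ i, α' i ≠ 0) → (∀ i, α i = ((g * (α' i).val : ℕ) : ZMod m)) →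
      FermatCharacter.Claim (m / g) r α' → FermatCharacter.Claim m r α := by
  intro m g r α' α hg hgm hne hα hC
  obtain ⟨M, rfl⟩ := hgm
  revert α' α
  rw [Nat.mul_div_cancel_left M hg]
  intro α' α hne hα hC
  obtain rfl : α = fun i => ((g * (α' i).val : ℕ) : ZMod (g * M)) := funext hα
  exact hPull M g r α' hg hne hC

/-- **PART (b) from its two geometric inputs.** Granted, for every level `m`, multiplier `k ≥ 1`,
dimension `2r` and zero-free character `α'` of level `m`, the pull-back implication `hPull`
(claim_m(α') ⟹ claim_{km}(k • α'), by `π^*`) and the push-forward implication `hPush`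
(claim_{km}(k • α') ⟹ claim_m(α'), by `π_* π^* = deg π`), one has
`claim_m(s) ⟺ claim_{km}(k • s)` for every non-empty Hodge multiset `s` of level `m`: realise `s`
by a Hodge character `α'` of some `X²ᵃₘ` (`IsHodgeMultiset.exists_isHodge_even`); `k • α'`
realises `k • s`, and claim depends only on the value multiset (`claimMultiset_univ_val_map_iff`,
the symmetric group acting on `Xⁿ_M`). [cite: Aoki1987, Cor. 2-3 (p. 388)]
[cite: daSilva2021HodgeFermat, Thm. 2.8] [cite: ShiodaKatsura1979, §1] -/
theorem claimMultiset_levelRaise_iff_of_pull_push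
    (hPull : ∀ (m k r : ℕ) (α' : Fin (2 * r + 2) → ZMod m), 0 < k → (∀ i, α' i ≠ 0) →
      FermatCharacter.Claim m r α' →
        FermatCharacter.Claim (k * m) r (fun i => ((k * (α' i).val : ℕ) : ZMod (k * m))))
    (hPush : ∀ (m k r : ℕ) (α' : Fin (2 * r + 2) → ZMod m), 0 < k → (∀ i, α' i ≠ 0) →
      FermatCharacter.Claim (k * m) r (fun i => ((k * (α' i).val : ℕ) : ZMod (k * m))) →
        FermatCharacter.Claim m r α') :
    ∀ (m k : ℕ) [NeZero m], 0 < k → ∀ s : Multiset (ZMod m), s ≠ 0 → IsHodgeMultiset s →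
      (ClaimMultiset m s ↔ ClaimMultiset (k * m) (LevelRaise[k, m, s])) := by
  intro m k _ hk s hs0 hs
  haveI : NeZero (k * m) := ⟨Nat.mul_ne_zero hk.ne' (NeZero.ne m)⟩
  obtain ⟨a, α', hα', hα's⟩ := hs.exists_isHodge_even hs0
  -- the raised character `k • α'` realises `k • s`
  have hβs : univ.val.map (fun i => ((k * (α' i).val : ℕ) : ZMod (k * m))) = LevelRaise[k, m, s] := by
    rw [← hα's, Multiset.map_map]
    rfl
  refine ⟨fun hC => ?_, fun hC => ?_⟩
  · have hC' : ClaimMultiset m (univ.val.map α') := by rwa [hα's]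
    rw [← hβs, claimMultiset_univ_val_map_iff]
    exact hPull m k a α' hk hα'.1.1 ((claimMultiset_univ_val_map_iff α').1 hC')
  · have hC' : ClaimMultiset (k * m) (univ.val.map fun i => ((k * (α' i).val : ℕ) : ZMod (k * m))) := by
      rwa [hβs]
    rw [← hα's, claimMultiset_univ_val_map_iff]
    exact hPush m k a α' hk hα'.1.1 ((claimMultiset_univ_val_map_iff _).1 hC')

/-! ### Toolkit for the saturation certificates `D33`, `D39`, `D99` (level-generic bookkeeping)

Each degree certificate of the line shows that every Hodge multiset of `ℤ/m` is stably ℤ-reachable from the printed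
supply, from a finite certificate (lead's `calc/d33.py`, `calc/d99.py`) re-checked by the kernel; the generic part is:
`sum_count_mul_eq_zero_of_cert` — a unit-combination certificate (`Σ_t μ_t · 2⟨tx⟩ = m Σ_t μ_t + D · w(x)` for all
`x ≠ 0`) yields the linear relation `Σ_x c_x(s) w(x) = 0` on the count vector of every Hodge multiset `s` (sum Shioda's
conditions PJA §1 eq. (2) with the weights) — and some multiset algebra. -/


/-- `mNormSum` of a map through multiplicities, in `ℤ`. [folklore] -/
theorem int_mNormSum_map [NeZero m] (s : Multiset (ZMod m)) (f : ZMod m → ZMod m) :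
    (mNormSum (s.map f) : ℤ) = ∑ x, (Multiset.count x s : ℤ) * ((f x).val : ℤ) := by
  unfold mNormSum
  rw [Multiset.map_map, sum_map_eq_sum_count_mul s (ZMod.val ∘ f)]
  push_cast
  simp only [Function.comp_apply]

/-- Swapping a list sum of weighted finite sums. [folklore] -/
theorem list_sum_mul_sum_swap [NeZero m] (L : List (ZMod m × ZMod m × ℤ)) (c : ZMod m → ℤ)
    (g : ZMod m × ZMod m × ℤ → ZMod m → ℤ) :
    (L.map fun e ↦ e.2.2 * ∑ x, c x * g e x).sum = ∑ x, c x * (L.map fun e ↦ e.2.2 * g e x).sum := by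
  induction L with
  | nil => simp
  | cons e L ih =>
    simp only [List.map_cons, List.sum_cons]
    rw [ih, Finset.mul_sum, ← Finset.sum_add_distrib]
    exact Finset.sum_congr rfl fun x _ ↦ by ring

/-- **A unit-combination certificate yields a linear relation on count vectors of Hodge multisets.**
`L` lists units `t` of `ℤ/m` with their inverses and integer weights `μ_t`; if
`Σ_t μ_t · 2⟨tx⟩ = m Σ_t μ_t + D · w(x)` for every `x ≠ 0` (`D ≠ 0`), then `Σ_x c_x(s) · w(x) = 0` for
every Hodge multiset `s` (sum the conditions `2 Σ_x c_x ⟨tx⟩ = m · #s` with the weights `μ_t`; the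
residue `0` does not occur in `s`). [cite: Shioda1979PJA, §1 eq. (2)] -/
theorem sum_count_mul_eq_zero_of_cert [NeZero m] (L : List (ZMod m × ZMod m × ℤ))
    (hL : ∀ e ∈ L, e.1 * e.2.1 = 1) (w : ZMod m → ℤ) {D : ℤ} (hD : D ≠ 0)
    (htab : ∀ x : ZMod m, x ≠ 0 →
      (L.map fun e ↦ e.2.2 * (2 * (((e.1 * x).val : ℕ) : ℤ))).sum =
        (m : ℤ) * (L.map fun e ↦ e.2.2).sum + D * w x)
    {s : Multiset (ZMod m)} (hs : IsHodgeMultiset s) :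
    ∑ x, (Multiset.count x s : ℤ) * w x = 0 := by
  set c : ZMod m → ℤ := fun x ↦ (Multiset.count x s : ℤ) with hc
  have hunit : ∀ e ∈ L, ∑ x, c x * (2 * (((e.1 * x).val : ℕ) : ℤ)) = (m : ℤ) * (Multiset.card s : ℤ) := by
    intro e he
    have h := hs.2 (Units.mkOfMulEqOne e.1 e.2.1 (hL e he))
    rw [Units.val_mkOfMulEqOne] at h
    have h' : ((2 * mNormSum (s.map fun a ↦ e.1 * a) : ℕ) : ℤ) = ((m * Multiset.card s : ℕ) : ℤ) := by
      exact_mod_cast h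
    push_cast at h'
    rw [int_mNormSum_map, Finset.mul_sum] at h'
    rw [← h']
    exact Finset.sum_congr rfl fun x _ ↦ by simp only [hc]; ring
  have c0 : c 0 = 0 := by
    simp only [hc, Nat.cast_eq_zero]
    exact Multiset.count_eq_zero.2 fun h0 ↦ hs.1.1 0 h0 rfl
  have hsum : (L.map fun e ↦ e.2.2 * ∑ x, c x * (2 * (((e.1 * x).val : ℕ) : ℤ))).sum =
      (L.map fun e ↦ e.2.2).sum * ((m : ℤ) * (Multiset.card s : ℤ)) := by
    rw [← List.sum_map_mul_right]
    exact congrArg List.sum (List.map_congr_left fun e he ↦ by rw [hunit e he])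
  rw [list_sum_mul_sum_swap L c (fun e x ↦ 2 * (((e.1 * x).val : ℕ) : ℤ))] at hsum
  have hpt : ∀ x, c x * (L.map fun e ↦ e.2.2 * (2 * (((e.1 * x).val : ℕ) : ℤ))).sum =
      c x * ((m : ℤ) * (L.map fun e ↦ e.2.2).sum) + D * (c x * w x) := by
    intro x
    by_cases hx : x = 0
    · subst hx; simp [c0]
    · rw [htab x hx]; ring
  simp only [hpt, Finset.sum_add_distrib, ← Finset.sum_mul, ← Finset.mul_sum] at hsum
  have hcard : ∑ x, c x = (Multiset.card s : ℤ) := by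
    simp only [hc, card_eq_sum_count s]; push_cast; rfl
  rw [hcard] at hsum
  have hD' : D * ∑ x, c x * w x = 0 := by linarith
  exact (mul_eq_zero.1 hD').resolve_left hD

/-- `Multiset.map` of a finite sum of scaled multisets. [folklore] -/
theorem map_sum_nsmul {ι α β : Type*} [DecidableEq ι] (f : α → β) (F : Finset ι) (c : ι → ℕ)
    (X : ι → Multiset α) :
    (∑ a ∈ F, c a • X a).map f = ∑ a ∈ F, c a • (X a).map f := by
  induction F using Finset.induction_on with
  | empty => simp
  | insert a F ha ih => rw [Finset.sum_insert ha, Finset.sum_insert ha, Multiset.map_add, Multiset.map_nsmul, ih]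

/-- Sum of a scaled family of multisets. [folklore] -/
theorem sum_nsmul' {α : Type*} (n : ℕ) (X : Multiset (Multiset α)) : (n • X).sum = n • X.sum :=
  map_nsmul Multiset.sumAddMonoidHom n X

/-- Sum of a finite sum of scaled families of multisets. [folklore] -/
theorem sum_sum_nsmul {ι α : Type*} [DecidableEq ι] (F : Finset ι) (c : ι → ℕ)
    (X : ι → Multiset (Multiset α)) :
    (∑ a ∈ F, c a • X a).sum = ∑ a ∈ F, c a • (X a).sum := by
  induction F using Finset.induction_on with
  | empty => simp
  | insert a F ha ih => rw [Finset.sum_insert ha, Finset.sum_insert ha, Multiset.sum_add, sum_nsmul', ih]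

/-- Mapping a sum of multisets. [folklore] -/
theorem map_multiset_sum {α β : Type*} (f : α → β) (X : Multiset (Multiset α)) :
    (X.sum).map f = (X.map (Multiset.map f)).sum := by
  induction X using Multiset.induction_on with
  | empty => simp
  | cons u X ih => rw [Multiset.sum_cons, Multiset.map_add, ih, Multiset.map_cons, Multiset.sum_cons]

end Summit.HodgeConjecture.HodgeConjecture.Theorems.CancelByAnyClaimLattice

end
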